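import Summits.QuantumFields.YangMills.Theses.SqueezedSkewness
import Summits.QuantumFields.YangMills.Theorems.ThermalDescentHypercubeSeamGlue
import Summits.QuantumFields.YangMills.Theorems.ThermalDescentTransportIdentity
import Summits.QuantumFields.YangMills.Theorems.ThermalDescentOddTorusRPHolds
import HarnessLib

/-!
# Route `SqueezedSkewness`, item `HypercubeSeam` (stmt-QuantumFields-27937) — the shared ThermalDescent statement

The descent-bridge split of `PointlikeMirrorFloors` (route rev 5, commit 175227657669) lists ThermalDescent's
`HypercubeSeam` verbatim; ThermalDescent closed it by split (TransportIdentity 27342, OddTorusRP 27343, glue 27344).  This file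
proves the SqueezedSkewness copy by composing those three landed theorems (the two `def`s have identical bodies).

R3/RECORD framing: an unconditional transfer-matrix identity/inequality; NT and the Yang–Mills mass gap are NOT proved here.
-/

set_option autoImplicit false

namespace Summit.QuantumFields.YangMills.Theorems

/-- `SqueezedSkewness.HypercubeSeam` (verbatim `ThermalDescent.HypercubeSeam`) from ThermalDescent's landed split. -/
theorem squeezedSkewness_hypercubeSeam :
    Summit.QuantumFields.YangMills.Theses.SqueezedSkewness.HypercubeSeam := by
  have h : Summit.QuantumFields.YangMills.Theses.ThermalDescent.HypercubeSeam :=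
    thermalDescent_hypercubeSeamGlue
      Summit.QuantumFields.YangMills.Theorems.ThermalDescentTransportIdentity.thermalDescent_transportIdentity
      Summit.QuantumFields.YangMills.Theorems.ThermalDescentOddTorusRPHolds.thermalDescent_oddTorusRP
  exact h

end Summit.QuantumFields.YangMills.Theorems
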